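import Summits.Ventures.PercRepro.RankDistBookLevels

/-!
# PercRepro — THE ROW (SC) IS FALSE: `ShadowCumulative (B_11 ⊕ B_12) 25 23` fails (p9, gen 23)

`B_11 ⊕ B_12` (`bookSum`: the two books on the two summands of `Option (Fin 11 × Bool) ⊕ Option (Fin 12 × Bool)`,
Mathlib's `disjointSum`) is a simple, loopless, coloop-free graphic matroid on `48` elements of rank `25`, on the
tight layer `(25, 23)`. By the landed convolution `card_shadowLev_disjointSum` (`RankDistDirectSum`) and the book
levels (`RankDistBookLevels`): `s_23 = s_11(B_11) · s_12(B_12) = 651587 · 2129860` and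
`s_24 = s_11(B_11) · s_13(B_12) + s_12(B_11) · s_12(B_12) = 651587 · 1058786 + 352246 · 2129860`, and the row
(SC) at its single interior level `u = 24` asks `s_23 · C(48, 24) ≤ s_24 · C(48, 23)`, i.e. `25 · s_23 ≤ 24 · s_24`
(`C(48, 24) · 24 = C(48, 23) · 25`): `34,694,727,195,500 ≤ 34,563,020,614,608` is FALSE.
**`not_shadowCumulative_bookSum`: the candidate row C-048 `ShadowCumulative M p q` (RankDistCumulative) does not
hold for every finite matroid** — it fails on `B_11 ⊕ B_12`; the strengthening route (SC) ⟹ C-025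
(`rls_of_shadowCumulative`) stays a theorem, and C-025 itself holds on this matroid with room (`#𝓑 = 381,681,664`
against `c_24 ≥ s_24`). Nothing here moves any window of the crux.
-/

namespace PercRepro.RankDist

open Set Finset _root_.Matroid PercRepro.ThmH

/-! ## The shadow levels above the rank vanish -/

/-- A shadow level above the rank of the matroid is empty. -/
lemma card_shadowLev_eq_zero_of_eRank_lt {α : Type} (M : Matroid α) [M.Finite] {p v : ℕ}
    (hr : M.eRank = (p : ℕ∞)) (hv : p < v) (𝒜 : Finset (Finset α)) : (shadowLev M v 𝒜).card = 0 := by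
  rw [Finset.card_eq_zero, Finset.eq_empty_iff_forall_notMem]
  intro A hA
  obtain ⟨hAE, hrk, -⟩ := (mem_shadowLev M).1 hA
  have h1 := M.eRk_le_eRank A
  rw [hr, eRk_eq_coe_rk M hAE, hrk] at h1
  have : v ≤ p := by exact_mod_cast h1
  omega

/-! ## `B_11 ⊕ B_12` -/

/-- The ground type of `B_11 ⊕ B_12`. -/
abbrev BookSumIx : Type := Option (Fin 11 × Bool) ⊕ Option (Fin 12 × Bool)

/-- `B_11` on the left summand. -/
noncomputable abbrev bookL : Matroid BookSumIx :=
  book (Sum.inl : Option (Fin 11 × Bool) → BookSumIx) Sum.inl_injective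

/-- `B_12` on the right summand. -/
noncomputable abbrev bookR : Matroid BookSumIx :=
  book (Sum.inr : Option (Fin 12 × Bool) → BookSumIx) Sum.inr_injective

/-- The two books have disjoint ground sets. -/
lemma disjoint_bookL_bookR : Disjoint bookL.E bookR.E := by
  rw [book_ground, book_ground]
  exact Set.isCompl_range_inl_range_inr.disjoint

/-- `B_11 ⊕ B_12`. -/
noncomputable abbrev bookSum : Matroid BookSumIx := bookL.disjointSum bookR disjoint_bookL_bookR

/-- `B_11 ⊕ B_12` is a finite matroid. -/
lemma bookSum_finite : bookSum.Finite :=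
  ⟨by rw [disjointSum_ground_eq]; exact bookL.ground_finite.union bookR.ground_finite⟩

/-- `s_11(B_11) = 651587`. -/
lemma card_shadowLev_bookL_q : (shadowLev bookL 11 (PerFlat.Uq bookL 12 11)).card = 651587 := by
  have := card_shadowLev_book_q (Sum.inl : Option (Fin 11 × Bool) → BookSumIx) Sum.inl_injective
  norm_num at this
  exact this

/-- `s_12(B_11) = 352246`. -/
lemma card_shadowLev_bookL_p : (shadowLev bookL 12 (PerFlat.Uq bookL 12 11)).card = 352246 := by
  have := card_shadowLev_book_p (Sum.inl : Option (Fin 11 × Bool) → BookSumIx) Sum.inl_injective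
  norm_num at this
  exact this

/-- `s_12(B_12) = 2129860`. -/
lemma card_shadowLev_bookR_q : (shadowLev bookR 12 (PerFlat.Uq bookR 13 12)).card = 2129860 := by
  have := card_shadowLev_book_q (Sum.inr : Option (Fin 12 × Bool) → BookSumIx) Sum.inr_injective
  norm_num at this
  exact this

/-- `s_13(B_12) = 1058786`. -/
lemma card_shadowLev_bookR_p : (shadowLev bookR 13 (PerFlat.Uq bookR 13 12)).card = 1058786 := by
  have := card_shadowLev_book_p (Sum.inr : Option (Fin 12 × Bool) → BookSumIx) Sum.inr_injective
  norm_num at this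
  exact this

/-- The tight-layer data of `B_11`. -/
lemma bookL_data : (gr bookL).card = 12 + 11 ∧ bookL.eRank = ((12 : ℕ) : ℕ∞) :=
  ⟨card_gr_book _ Sum.inl_injective, eRank_book _ Sum.inl_injective⟩

/-- The tight-layer data of `B_12`. -/
lemma bookR_data : (gr bookR).card = 13 + 12 ∧ bookR.eRank = ((13 : ℕ) : ℕ∞) :=
  ⟨card_gr_book _ Sum.inr_injective, eRank_book _ Sum.inr_injective⟩

/-- **`s_23(B_11 ⊕ B_12) = 651587 · 2129860`**. -/
lemma card_shadowLev_bookSum_q [hS : bookSum.Finite] :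
    (shadowLev bookSum 23 (PerFlat.Uq bookSum 25 23)).card = 651587 * 2129860 := by
  have h := card_shadowLev_disjointSum_bot bookL bookR disjoint_bookL_bookR bookL_data.1 bookL_data.2
    bookR_data.1 bookR_data.2
  rw [card_shadowLev_bookL_q, card_shadowLev_bookR_q] at h
  exact h

/-- **`s_24(B_11 ⊕ B_12) = 651587 · 1058786 + 352246 · 2129860`**. -/
lemma card_shadowLev_bookSum_mid [hS : bookSum.Finite] :
    (shadowLev bookSum 24 (PerFlat.Uq bookSum 25 23)).card = 651587 * 1058786 + 352246 * 2129860 := by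
  have h := card_shadowLev_disjointSum bookL bookR disjoint_bookL_bookR bookL_data.1 bookL_data.2
    bookR_data.1 bookR_data.2 24
  rw [h]
  rw [Finset.sum_eq_add 11 12 (by norm_num)]
  · rw [card_shadowLev_bookL_q, card_shadowLev_bookL_p, card_shadowLev_bookR_q, card_shadowLev_bookR_p]
  · intro c hc hne
    rw [Finset.mem_range] at hc
    rcases Nat.lt_or_ge c 11 with hlt | hge
    · rw [card_shadowLev_eq_zero_of_lt bookL hlt, Nat.zero_mul]
    · have h13 : 13 ≤ c := by omega
      rw [card_shadowLev_eq_zero_of_eRank_lt bookL bookL_data.2 (by omega), Nat.zero_mul]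
  · intro h; exact absurd (Finset.mem_range.2 (by norm_num)) h
  · intro h; exact absurd (Finset.mem_range.2 (by norm_num)) h

/-- **THE ROW (SC) FAILS ON `B_11 ⊕ B_12`**: `ShadowCumulative (B_11 ⊕ B_12) 25 23` is false — at its single
interior level `u = 24`, `s_23 · C(48, 24) > s_24 · C(48, 23)` (`25 · s_23 = 34,694,727,195,500 >
24 · s_24 = 34,563,020,614,608`). -/
theorem not_shadowCumulative_bookSum [hS : bookSum.Finite] : ¬ ShadowCumulative bookSum 25 23 := by
  intro h
  have h24 := h 24 (by norm_num) (by norm_num)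
  rw [card_shadowLev_bookSum_q, card_shadowLev_bookSum_mid] at h24
  have hc : Nat.choose 48 24 * 24 = Nat.choose 48 23 * 25 := by
    have := Nat.choose_succ_right_eq 48 23
    simpa using this
  have hpos : 0 < Nat.choose 48 23 := Nat.choose_pos (by norm_num)
  have h1 : (651587 * 2129860) * (Nat.choose 48 23 * 25)
      ≤ (651587 * 1058786 + 352246 * 2129860) * Nat.choose 48 23 * 24 := by
    calc (651587 * 2129860) * (Nat.choose 48 23 * 25) = (651587 * 2129860) * (Nat.choose 48 24 * 24) := by
          rw [hc]
      _ = (651587 * 2129860) * Nat.choose 48 24 * 24 := by ring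
      _ ≤ (651587 * 1058786 + 352246 * 2129860) * Nat.choose 48 23 * 24 :=
          Nat.mul_le_mul_right 24 (by simpa using h24)
  have h2 : (651587 * 2129860) * 25 ≤ (651587 * 1058786 + 352246 * 2129860) * 24 := by
    have h3 : ((651587 * 2129860) * 25) * Nat.choose 48 23
        ≤ ((651587 * 1058786 + 352246 * 2129860) * 24) * Nat.choose 48 23 := by
      calc ((651587 * 2129860) * 25) * Nat.choose 48 23 = (651587 * 2129860) * (Nat.choose 48 23 * 25) := by ring
        _ ≤ (651587 * 1058786 + 352246 * 2129860) * Nat.choose 48 23 * 24 := h1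
        _ = ((651587 * 1058786 + 352246 * 2129860) * 24) * Nat.choose 48 23 := by ring
    exact Nat.le_of_mul_le_mul_right h3 hpos
  norm_num at h2

/-- **The row (SC) refuted, with its finiteness instance supplied**: the matroid `B_11 ⊕ B_12` is finite and
violates `ShadowCumulative` at `(25, 23)`. -/
theorem not_shadowCumulative_bookSum' :
    ¬ @ShadowCumulative BookSumIx _ bookSum bookSum_finite 25 23 :=
  @not_shadowCumulative_bookSum bookSum_finite

end PercRepro.RankDist
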